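import Literature.AlgebraicGeometry.Resolution.ArithmeticalThreefoldsDescentTail
import Literature.AlgebraicGeometry.Resolution.ValuationExtensionToCompletion
import Literature.AlgebraicGeometry.Resolution.FormalEquidimensionality
import Literature.AlgebraicGeometry.Resolution.FormalFibres
import Literature.AlgebraicGeometry.Resolution.ResidueAlgebraicTower
import HarnessLib

/-!
# Cossart–Piltant 2019, proof of Prop. 4.8: algebraization of a regular local ring of `Spec Â` along `v`

Topic: `Literature/AlgebraicGeometry/Resolution` (proofs only; no new notions, no new named
facts). The named fact `CossartPiltant2019LU3OfComplete` (`ArithmeticalThreefolds.lean`) is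
journal Prop. 4.8 = arXiv v1 Prop. 4.6 of

* V. Cossart, O. Piltant, *Resolution of singularities of arithmetical threefolds*, J. Algebra
  529 (2019) 268–535 = arXiv:1412.0868,

"Assume that (LU) holds for every complete local domain of dimension three. Then theorem 1.1
holds", whose printed proof (v1 pp. 52–53) descends (LU) from the formal completion `Â` of a
quasi-excellent local domain `(A, 𝔪, k)` of dimension three, `K = QF(A)`, to `A`. After the
construction of a resolution `Ŷ → Spec Â`, of the centre `ŷ ∈ Ŷ` of an extension `v̂` of the
valuation `v` to `K̂₁ = QF(Â/P̂₁)`, and of elements `g₁, …, g_d ∈ 𝒪_{Ŷ,ŷ} ∩ K` by Lemma 4.7 and a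
density argument ((510)–(512)), the proof ends (p. 53):

> "Let now `g_j := g'_j{}^a ∏ g_i^{-m_{ij}} = u'_j{}^a ∏ δ̂^{-m_{ij}} ∈ 𝒪_{Ŷ,ŷ} ∩ K` (512) and `T`
> be the integral closure of `A[g₁, …, g_d]` in `K`. By [EGA IV] corollary 7.7.3, `T` is a
> finitely generated `A`-algebra. Furthermore, we have
> `A ⊆ T ⊆ 𝒪_{Ŷ,ŷ} ∩ K ⊂ 𝒪_v̂ ∩ K = 𝒪_v` by (5101)-(5102). To complete the proof, it must be
> proved that `T_P` is regular, where `P := m_v ∩ T`. […] so `𝒪_{Ŷ,ŷ} = T'_{P'}` and the proof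
> is complete."

The part from "it must be proved that `T_P` is regular" on is PROVED in
`ArithmeticalThreefoldsDescentTail.lean` (`isRegularLocalRing_localization_of_descent_data`).
This file PROVES the preceding sentences on top of it, i.e. the whole end of the proof from
(511)–(512) on, as an abstract ALGEBRAIZATION statement
(`exists_adjoin_isRegularLocalRing_of_generators`): given the regular local ring `S = 𝒪_{Ŷ,ŷ}`
(essentially of finite type over `Â`, dominating it, inside `K̂₁`, dominated by `𝒪_v̂`) and
finitely many elements of `𝔪_S` COMING FROM `K` which generate an `𝔪_S`-primary ideal (what
(511)–(512) deliver: `g_j = unit · w_j^a` for a regular system of parameters `(w_j)` of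
`𝒪_{Ŷ,ŷ}`), the conclusion of (LU) for `A` at `v` holds — there is a finitely generated
`A[t] ⊆ 𝒪_v` (namely `T`) regular at the centre `𝔪_v ∩ A[t]`. Ingredients: Cossart–Piltant's
`T` is finitely generated (`exists_adjoin_eq_integralClosure_adjoin`,
`IntegralClosureEssFiniteType.lean`, for `A` essentially of finite type over a field — EGA IV
7.7.3 in the source); `T ⊆ 𝒪_{Ŷ,ŷ} ∩ K` because `𝒪_{Ŷ,ŷ}` is regular, hence normal (Matsumura
19.4, `isIntegrallyClosed_of_isRegularLocalRing`), with fraction field `K̂₁`; `𝔪_v ∩ T = m_ŷ ∩ T`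
because `𝒪_v̂` dominates `𝒪_{Ŷ,ŷ}` and `𝒪_v̂ ∩ K = 𝒪_v`; `√(P𝒪_{Ŷ,ŷ}) = m_ŷ` because `P ∋ g_j`.

Also PROVED here, for whoever supplies `𝒪_{Ŷ,ŷ}` and the `g_j` (the part of the printed proof
that rests on Thm. 1.1 for `Spec Â` by patching, journal Prop. 4.6, and on Lemma 4.7 = [CoP1]
Prop. 6.2, not in the tree):

* `exists_eval₂_mem_maximalIdeal_of_valuation(_adicCompletion)` — the residue field of
  `𝒪_{Ŷ,ŷ}` is algebraic over `k` (elementary form), from the corresponding property of `𝒪_v̂`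
  over `Â/P̂₁` furnished by `exists_minimalPrime_valuationSubring_adicCompletion`
  (`ValuationExtensionToCompletion.lean`);
* `CossartPiltant2019LUComplete3.cpLocalUniformization_of_surjective` — "By assumption in this
  proposition": for `A = B_𝔭` of dimension three (`B` a domain of finite type over a field) every
  formal branch `Â/P̂` is a complete Noetherian local domain of dimension three
  (`FormalEquidimensionality.lean`; `isAdicComplete_of_surjective`), so the hypothesis
  `CossartPiltant2019LUComplete3` gives (LU) for it.

Everything is PROVED; no definitions, no named facts.

## Sources

* V. Cossart, O. Piltant, J. Algebra 529 (2019) 268–535 = arXiv:1412.0868, proof of Prop. 4.8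
  (arXiv v1: Prop. 4.6, pp. 52–53), formulas (510)–(512), (5101)–(5102). [CossartPiltant2019]
* H. Matsumura, *Commutative Ring Theory*, CUP 1986, Thm. 19.4; §32 p. 257. [Matsumura1987]
* A. Grothendieck, EGA IV₂, 7.7.3, 7.9.3.1 (as quoted in the source).
-/

noncomputable section

open IsLocalRing Polynomial

namespace Literature.AlgebraicGeometry.Resolution

universe u

/-! ## `𝒪 ∩ K`: pulling a subring of `K̂₁` back to `K` -/

section Preimage

variable {A K : Type u} [CommRing A] [Field K] [Algebra A K]
  {S K₁ : Type u} [CommRing S] [Field K₁] [Algebra A S] [Algebra A K₁] [Algebra S K₁]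
  [IsScalarTower A S K₁] [Algebra K K₁] [IsScalarTower A K K₁]

/-- **`𝒪 ∩ K`.** For `A`-algebras `S ↪ K̂₁ ← K` (`S` embedded in the field `K̂₁`, `K` a field
mapping to `K̂₁`), the elements of `K` whose image lies in (the image of) `S` form an
`A`-subalgebra `S ∩ K` of `K`, which maps to `S` over `A` compatibly with `K → K̂₁`
(Cossart–Piltant's `𝒪_{Ŷ,ŷ} ∩ K`). [folklore] -/
theorem exists_subalgebra_algHom_of_injective (hSK₁ : Function.Injective (algebraMap S K₁)) :
    ∃ (SK : Subalgebra A K) (φ : SK →ₐ[A] S),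
      (∀ x : K, x ∈ SK ↔ ∃ y : S, algebraMap S K₁ y = algebraMap K K₁ x) ∧
      ∀ x : SK, algebraMap S K₁ (φ x) = algebraMap K K₁ (x : K) := by
  let ιK : K →ₐ[A] K₁ := IsScalarTower.toAlgHom A K K₁
  let ιS : S →ₐ[A] K₁ := IsScalarTower.toAlgHom A S K₁
  let SK : Subalgebra A K := ιS.range.comap ιK
  let e : S ≃ₐ[A] ιS.range := AlgEquiv.ofInjective ιS hSK₁
  have hmem : ∀ x : K, x ∈ SK ↔ ιK x ∈ ιS.range := fun x => Subalgebra.mem_comap _ _ _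
  let φ₀ : SK →ₐ[A] ιS.range :=
    (ιK.comp SK.val).codRestrict ιS.range (fun x => (hmem x.1).mp x.2)
  refine ⟨SK, e.symm.toAlgHom.comp φ₀, fun x => ?_, fun x => ?_⟩
  · rw [hmem, AlgHom.mem_range]
    rfl
  · change ((e (e.symm (φ₀ x))) : K₁) = _
    rw [AlgEquiv.apply_symm_apply]
    rfl

end Preimage

/-! ## The algebraization statement -/

section Algebraization

variable {A : Type u} [CommRing A] [IsDomain A] [IsLocalRing A]
  {K : Type u} [Field K] [Algebra A K] [IsFractionRing A K]

/-- For a valuation ring `O'` of `K̂₁` containing the local ring `S` and dominating it, an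
element of `S` lies in `𝔪_S` iff its value is `< 1`. [folklore] -/
theorem mem_maximalIdeal_iff_valuation_lt_one {S K₁ : Type u} [CommRing S] [IsLocalRing S]
    [Field K₁] [Algebra S K₁] (O' : ValuationSubring K₁) (hSO' : ∀ s : S, algebraMap S K₁ s ∈ O')
    (hdomS : ∀ s ∈ maximalIdeal S, O'.valuation (algebraMap S K₁ s) < 1) (s : S) :
    s ∈ maximalIdeal S ↔ O'.valuation (algebraMap S K₁ s) < 1 := by
  refine ⟨hdomS s, fun hlt => ?_⟩
  by_contra hs
  have hu : IsUnit s := by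
    by_contra hnu
    exact hs ((IsLocalRing.mem_maximalIdeal s).mpr hnu)
  let j : S →+* O' := (algebraMap S K₁).codRestrict O' hSO'
  have h1 : O'.valuation (algebraMap S K₁ s) = 1 := (O'.valuation_eq_one_iff (j s)).mp (hu.map j)
  exact (ne_of_lt hlt) h1

set_option maxHeartbeats 800000 in
/-- **Cossart–Piltant 2019, proof of Prop. 4.8 (arXiv v1 Prop. 4.6, p. 53), from (511)–(512)
on: algebraization.** PROVED in the following abstract form. Data: a local domain `A`
essentially of finite type over a field `k` (so a G-ring, and Nagata), with fraction field `K`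
and completion `Â`; a field `K̂₁` under `Â` with kernel a minimal prime `P̂₁` of `Â` and
`K̂₁ = Frac(Â/P̂₁)`, containing `K` compatibly; a regular local ring `S` (in the source
`𝒪_{Ŷ,ŷ}`) essentially of finite type over `Â`, dominating `Â`, embedded in `K̂₁` over `Â`, with
residue field algebraic over that of `A`; a valuation ring `O'` of `K̂₁` (in the source `𝒪_v̂`)
containing `S` and dominating it (`ŷ` is the centre of `v̂`), restricting on `K` to `O`
(`= 𝒪_v`); and finitely many elements `g₁, …, g_n ∈ 𝔪_S` COMING FROM `K` (i.e. lying in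
`𝒪_{Ŷ,ŷ} ∩ K`) which generate an `𝔪_S`-primary ideal — in the source
`g_j = δ̂_j û_j^a` (`1 ≤ j ≤ r`, (511)) and `g_j = u'_j{}^a ∏ δ̂_j^{-m_{ij}}` (`r < j ≤ d`, (512))
with `δ̂_j` units and `(û₁, …, û_r, u'_{r+1}, …, u'_d)` a regular system of parameters of
`𝒪_{Ŷ,ŷ}`, so that `(g₁, …, g_d)𝒪_{Ŷ,ŷ} = (û₁^a, …, u'_d{}^a)` has radical `m_ŷ`. Conclusion —
the conclusion of (LU) for `A` at `v` (`CPLocalUniformization`): there is a finite `t ⊆ K` with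
`A[t] ⊆ 𝒪_v` whose localisation at the centre `𝔪_v ∩ A[t]` is regular. Proof, as printed: "let
`T` be the integral closure of `A[g₁, …, g_d]` in `K`. By [EGA IV] corollary 7.7.3, `T` is a
finitely generated `A`-algebra" (`exists_adjoin_eq_integralClosure_adjoin`: `T = A[t]`);
"`A ⊆ T ⊆ 𝒪_{Ŷ,ŷ} ∩ K ⊂ 𝒪_v̂ ∩ K = 𝒪_v`" (`S` is regular, hence normal, Matsumura 19.4, with
fraction field `K̂₁`, so elements of `K` integral over `A[g] ⊆ S ∩ K` lie in `S ∩ K`); the centre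
`P := 𝔪_v ∩ T` equals `𝔪_S ∩ T` (`O'` dominates `S`) and `√(P𝒪_{Ŷ,ŷ}) ⊇ √((g)𝒪_{Ŷ,ŷ}) = m_ŷ`;
"it must be proved that `T_P` is regular" — this is the last paragraph of the printed proof,
`isRegularLocalRing_localization_of_descent_data` (`ArithmeticalThreefoldsDescentTail.lean`:
EGA IV 7.9.3.1, normality of `T'_{P'}`, Zariski's Main Theorem). What this leaves of the
printed proof is the construction of `𝒪_{Ŷ,ŷ}` and of the `g_j` (Thm. 1.1 for `Spec Â` by
patching, Lemma 4.7 = [CoP1] Prop. 6.2, and the density argument (5101)–(5102)).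
[cite: CossartPiltant2019, proof of Prop. 4.8 (arXiv v1: Prop. 4.6, p. 53), (511)–(512) and
the following paragraph] -/
theorem exists_adjoin_isRegularLocalRing_of_generators
    (k : Type u) [Field k] [Algebra k A] [Algebra.EssFiniteType k A]
    -- the completion side: `K̂₁ = Frac(Â/P̂₁)` for a minimal prime `P̂₁`
    {K₁ : Type u} [Field K₁] [Algebra (AdicCompletion (maximalIdeal A) A) K₁] [Algebra A K₁]
    [IsScalarTower A (AdicCompletion (maximalIdeal A) A) K₁] [Algebra K K₁] [IsScalarTower A K K₁]
    (hP₁ : RingHom.ker (algebraMap (AdicCompletion (maximalIdeal A) A) K₁) ∈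
      minimalPrimes (AdicCompletion (maximalIdeal A) A))
    (hK₁ : ∀ z : K₁, ∃ a b : AdicCompletion (maximalIdeal A) A,
      z = algebraMap _ K₁ a / algebraMap _ K₁ b)
    -- the regular local ring `S = 𝒪_{Ŷ,ŷ}` over `Â`, inside `K̂₁`
    {S : Type u} [CommRing S] [IsRegularLocalRing S] [Algebra (AdicCompletion (maximalIdeal A) A) S]
    [IsLocalHom (algebraMap (AdicCompletion (maximalIdeal A) A) S)]
    [Algebra.EssFiniteType (AdicCompletion (maximalIdeal A) A) S] [Algebra A S]
    [IsScalarTower A (AdicCompletion (maximalIdeal A) A) S] [Algebra S K₁]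
    [IsScalarTower (AdicCompletion (maximalIdeal A) A) S K₁]
    (hSK₁ : Function.Injective (algebraMap S K₁))
    (halg : ∀ x : S, ∃ p : A[X], (∃ i, p.coeff i ∉ maximalIdeal A) ∧
      p.eval₂ (algebraMap A S) x ∈ maximalIdeal S)
    -- the valuation rings: `O' = 𝒪_v̂ ⊇ S` dominating `S`, `O = O' ∩ K = 𝒪_v`
    (O' : ValuationSubring K₁) (hSO' : ∀ s : S, algebraMap S K₁ s ∈ O')
    (hdomS : ∀ s ∈ maximalIdeal S, O'.valuation (algebraMap S K₁ s) < 1)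
    (O : ValuationSubring K) (hO : O'.comap (algebraMap K K₁) = O)
    -- CP's `g_j ∈ 𝒪_{Ŷ,ŷ} ∩ K`, (511)-(512): in `𝔪_S`, from `K`, generating an `𝔪_S`-primary ideal
    (G : Finset S) (g : S → K) (hg : ∀ s ∈ G, algebraMap K K₁ (g s) = algebraMap S K₁ s)
    (hGm : ∀ s ∈ G, s ∈ maximalIdeal S)
    (hrad : ∀ Q : Ideal S, Q.IsPrime → (∀ s ∈ G, s ∈ Q) → Q = maximalIdeal S) :
    ∃ (t : Finset K) (h : (Algebra.adjoin A (t : Set K)).toSubring ≤ O.toSubring),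
      IsRegularLocalRing (Localization.AtPrime
        (Ideal.comap (Subring.inclusion h) (maximalIdeal O))) := by
  classical
  set Ah := AdicCompletion (maximalIdeal A) A with hAhdef
  -- `A` is a G-ring (essentially of finite type over a field)
  have hAexc : IsExcellentRing A :=
    (isExcellentRing_of_finiteType_field k k).of_essFiniteType ‹Algebra.EssFiniteType k A›
  have hA : IsGRing A := hAexc.isQuasiExcellentRing.isGRing
  -- `k → K` (for Nagata finiteness over `k`)
  letI : Algebra k K := ((algebraMap A K).comp (algebraMap k A)).toAlgebra
  haveI : IsScalarTower k A K := IsScalarTower.of_algebraMap_eq fun _ => rfl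
  -- `S` is a normal domain with fraction field `K̂₁`
  haveI : IsDomain S := isDomain_of_isRegularLocalRing S
  haveI : IsIntegrallyClosed S := isIntegrallyClosed_of_isRegularLocalRing S
  haveI : FaithfulSMul S K₁ := (faithfulSMul_iff_algebraMap_injective S K₁).mpr hSK₁
  haveI : IsFractionRing S K₁ := IsFractionRing.of_field S K₁ fun z => by
    obtain ⟨a, b, rfl⟩ := hK₁ z
    exact ⟨algebraMap Ah S a, algebraMap Ah S b, by
      rw [← IsScalarTower.algebraMap_apply Ah S K₁, ← IsScalarTower.algebraMap_apply Ah S K₁]⟩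
  haveI : IsScalarTower A S K₁ := IsScalarTower.of_algebraMap_eq fun a => by
    rw [IsScalarTower.algebraMap_apply A Ah S, ← IsScalarTower.algebraMap_apply Ah S K₁,
      ← IsScalarTower.algebraMap_apply A Ah K₁]
  -- `S ∩ K` and its map `φ` to `S`
  obtain ⟨SK, φ, hmemSK, hφ⟩ :=
    exists_subalgebra_algHom_of_injective (A := A) (K := K) (S := S) (K₁ := K₁) hSK₁
  -- `s₀ := {g_j}` and `T := A[t]`, the integral closure of `A[s₀]` in `K`
  set s₀ : Finset K := G.image g with hs₀def
  obtain ⟨t, hst, hint, htic⟩ := exists_adjoin_eq_integralClosure_adjoin (k := k) (A := A) (K := K) s₀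
  set T : Subalgebra A K := Algebra.adjoin A (t : Set K) with hTdef
  -- `A[s₀] ⊆ S ∩ K`
  have hs₀SK : Algebra.adjoin A (s₀ : Set K) ≤ SK := by
    rw [Algebra.adjoin_le_iff]
    intro x hx
    obtain ⟨s, hs, rfl⟩ := Finset.mem_image.mp (Finset.mem_coe.mp hx)
    exact (hmemSK _).mpr ⟨s, (hg s hs).symm⟩
  -- `T ⊆ S ∩ K`: elements of `K` integral over `A[s₀]` map to elements of `K̂₁` integral over `S`
  have hTSK : T ≤ SK := by
    intro x hx
    have hxint : IsIntegral (Algebra.adjoin A (s₀ : Set K)) x := (hint x).mp hx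
    let ψ₀ : Algebra.adjoin A (s₀ : Set K) →+* S :=
      (φ.comp (Subalgebra.inclusion hs₀SK)).toRingHom
    have hcomp : (algebraMap S K₁).comp ψ₀ =
        (algebraMap K K₁).comp (algebraMap (Algebra.adjoin A (s₀ : Set K)) K) := by
      ext y
      exact hφ (Subalgebra.inclusion hs₀SK y)
    have hint₁ : IsIntegral S (algebraMap K K₁ x) := by
      obtain ⟨p, hpm, hpx⟩ := hxint
      refine ⟨p.map ψ₀, hpm.map _, ?_⟩
      rw [eval₂_map, hcomp, ← hom_eval₂, hpx, map_zero]
    obtain ⟨y, hy⟩ := IsIntegrallyClosed.isIntegral_iff.mp hint₁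
    exact (hmemSK x).mpr ⟨y, hy⟩
  -- `T → S` over `A`
  letI : Algebra T S := (φ.comp (Subalgebra.inclusion hTSK)).toRingHom.toAlgebra
  haveI : IsScalarTower A T S := IsScalarTower.of_algebraMap_eq fun a =>
    ((φ.comp (Subalgebra.inclusion hTSK)).commutes a).symm
  have hTS : ∀ x : T, algebraMap S K₁ (algebraMap T S x) = algebraMap K K₁ (x : K) := fun x =>
    hφ (Subalgebra.inclusion hTSK x)
  -- the `g_j` lie in `T` and map back to themselves
  have hgT : ∀ s ∈ G, g s ∈ T := fun s hs =>
    Algebra.subset_adjoin (Finset.mem_coe.mpr (hst (Finset.mem_image_of_mem g hs)))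
  have hgS : ∀ s (hs : s ∈ G), algebraMap T S ⟨g s, hgT s hs⟩ = s := fun s hs =>
    hSK₁ (by rw [hTS]; exact hg s hs)
  -- `√(P S) = 𝔪_S` for `P := 𝔪_S ∩ T`
  have hrad' : ∀ Q : Ideal S, Q.IsPrime →
      ((maximalIdeal S).comap (algebraMap T S)).map (algebraMap T S) ≤ Q →
        Q = maximalIdeal S := by
    intro Q hQ hle
    refine hrad Q hQ fun s hs => ?_
    have hP : (⟨g s, hgT s hs⟩ : T) ∈ (maximalIdeal S).comap (algebraMap T S) := by
      rw [Ideal.mem_comap, hgS s hs]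
      exact hGm s hs
    have := hle (Ideal.mem_map_of_mem (algebraMap T S) hP)
    rwa [hgS s hs] at this
  -- the last paragraph of the printed proof: `T_P` is regular
  have hreg : IsRegularLocalRing
      (Localization.AtPrime ((maximalIdeal S).comap (algebraMap T S))) :=
    isRegularLocalRing_localization_of_descent_data hA hP₁ hK₁ hSK₁ T
      (Subalgebra.fg_adjoin_finset t) htic hrad' halg
  -- `T ⊆ 𝒪_v` and `P = 𝔪_v ∩ T`
  have hTO : T.toSubring ≤ O.toSubring := by
    intro x hx
    obtain ⟨y, hy⟩ := (hmemSK x).mp (hTSK hx)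
    change x ∈ O
    rw [← hO, ValuationSubring.mem_comap, ← hy]
    exact hSO' y
  refine ⟨t, hTO, ?_⟩
  have hideal : (maximalIdeal S).comap (algebraMap T S) =
      (Ideal.comap (Subring.inclusion hTO) (maximalIdeal O) : Ideal T.toSubring) := by
    ext x
    rw [Ideal.mem_comap, Ideal.mem_comap, ValuationSubring.valuation_lt_one_iff,
      mem_maximalIdeal_iff_valuation_lt_one O' hSO' hdomS, hTS,
      valuation_algebraMap_lt_one_iff_of_comap_eq' O O' hO]
    rfl
  have key : ∀ (P : Ideal T) [P.IsPrime],
      P = (Ideal.comap (Subring.inclusion hTO) (maximalIdeal O) : Ideal T.toSubring) →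
      IsRegularLocalRing (Localization.AtPrime P) →
      IsRegularLocalRing (Localization.AtPrime
        (Ideal.comap (Subring.inclusion hTO) (maximalIdeal O))) := by
    intro P _ hP h
    subst hP
    exact h
  exact key _ hideal hreg

end Algebraization

/-! ## The residue field of `S` is algebraic over that of `A` -/

section ResidueAlgebraic

variable {A R S K₁ : Type u} [CommRing A] [IsLocalRing A] [CommRing R] [IsLocalRing R]
  [CommRing S] [IsLocalRing S] [Field K₁] [Algebra A R] [Algebra R S] [Algebra A S]
  [IsScalarTower A R S] [Algebra S K₁] [Algebra R K₁] [IsScalarTower R S K₁]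

/-- **Residue algebraicity descends from `O'` over `R` to `S` over `A`.** Let `A → R → S` be
local rings with `𝔪_A R ⊆ 𝔪_R`, `A → R/𝔪_R` onto (same residue field, e.g. `R = Â/P`) and
`𝔪_R S ⊆ 𝔪_S`; let `S → K₁` land in a valuation ring `O'` dominating `S`, whose residue field is
algebraic over that of `R` in the elementary sense of `CPLocalUniformization` (every element of
`O'` is a root modulo `𝔪_{O'}` of a polynomial over `R` with a unit coefficient). Then every
element of `S` is a root modulo `𝔪_S` of a polynomial over `A` with a unit coefficient (the
hypothesis `halg` of `isRegularLocalRing_localization_of_descent_data` /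
`exists_adjoin_isRegularLocalRing_of_generators`; in the source: `κ(ŷ) ⊆ k_v̂` is algebraic over
`k`). Proof: evaluate in `S` (the value lies in `𝔪_{O'} ∩ S = 𝔪_S`) and replace the coefficients
by elements of `A` congruent modulo `𝔪_R`. [cite: CossartPiltant2019, proof of Prop. 4.8
(arXiv v1: Prop. 4.6, p. 53)] -/
theorem exists_eval₂_mem_maximalIdeal_of_valuation
    (hmA : ∀ a ∈ maximalIdeal A, algebraMap A R a ∈ maximalIdeal R)
    (hAR : ∀ r : R, ∃ a : A, r - algebraMap A R a ∈ maximalIdeal R)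
    (hRS : ∀ r ∈ maximalIdeal R, algebraMap R S r ∈ maximalIdeal S)
    (O' : ValuationSubring K₁) (hSO' : ∀ s : S, algebraMap S K₁ s ∈ O')
    (hdomS : ∀ s ∈ maximalIdeal S, O'.valuation (algebraMap S K₁ s) < 1)
    (halgR : ∀ x : O', ∃ p : R[X], (∃ i, p.coeff i ∉ maximalIdeal R) ∧
      O'.valuation (p.eval₂ (algebraMap R K₁) x) < 1) (x : S) :
    ∃ p : A[X], (∃ i, p.coeff i ∉ maximalIdeal A) ∧
      p.eval₂ (algebraMap A S) x ∈ maximalIdeal S := by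
  classical
  obtain ⟨p, ⟨i₀, hi₀⟩, hlt⟩ := halgR ⟨algebraMap S K₁ x, hSO' x⟩
  -- `p(x) ∈ 𝔪_S`
  have hpS : p.eval₂ (algebraMap R S) x ∈ maximalIdeal S := by
    rw [mem_maximalIdeal_iff_valuation_lt_one O' hSO' hdomS, hom_eval₂,
      ← IsScalarTower.algebraMap_eq]
    exact hlt
  -- `A → R/𝔪_R` is onto: lift the coefficients of `p` to `A`
  have hsurj : Function.Surjective ((residue R).comp (algebraMap A R)) := by
    intro z
    obtain ⟨r, rfl⟩ := residue_surjective z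
    obtain ⟨a, ha⟩ := hAR r
    refine ⟨a, ?_⟩
    rw [RingHom.comp_apply, ← sub_eq_zero, ← map_sub, residue_eq_zero_iff]
    rw [← neg_sub]
    exact Submodule.neg_mem _ ha
  obtain ⟨q, hq⟩ := Polynomial.map_surjective _ hsurj (p.map (residue R))
  have hcoeff : ∀ n, p.coeff n - algebraMap A R (q.coeff n) ∈ maximalIdeal R := by
    intro n
    have h := congrArg (fun f : (ResidueField R)[X] => f.coeff n) hq
    simp only [coeff_map, RingHom.comp_apply] at h
    rw [← residue_eq_zero_iff, map_sub, sub_eq_zero, h]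
  -- `(p - q)(x) ∈ 𝔪_R S ⊆ 𝔪_S`, hence `q(x) ∈ 𝔪_S`
  set q' : R[X] := q.map (algebraMap A R) with hq'def
  have hdiff : (p - q').eval₂ (algebraMap R S) x ∈ maximalIdeal S := by
    rw [eval₂_eq_sum_range]
    refine Ideal.sum_mem _ fun n _ => Ideal.mul_mem_right _ _ (hRS _ ?_)
    rw [coeff_sub, hq'def, coeff_map]
    exact hcoeff n
  have hqS : q'.eval₂ (algebraMap R S) x ∈ maximalIdeal S := by
    have : q'.eval₂ (algebraMap R S) x =
        p.eval₂ (algebraMap R S) x - (p - q').eval₂ (algebraMap R S) x := by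
      rw [eval₂_sub]; ring
    rw [this]
    exact Ideal.sub_mem _ hpS hdiff
  refine ⟨q, ⟨i₀, fun hi => hi₀ ?_⟩, ?_⟩
  · have h1 := hcoeff i₀
    have h2 : algebraMap A R (q.coeff i₀) ∈ maximalIdeal R := hmA _ hi
    have := Ideal.add_mem _ h1 h2
    rwa [sub_add_cancel] at this
  · rw [hq'def, eval₂_map, ← IsScalarTower.algebraMap_eq] at hqS
    exact hqS

end ResidueAlgebraic

section Completion

variable {A : Type u} [CommRing A] [IsLocalRing A] [IsNoetherianRing A]

/-- Every element of `Â` is congruent to an element of `A` modulo `𝔪_Â` (the residue fields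
agree, Mathlib `AdicCompletion.residueField_map_bijective`; cf.
`exists_sub_algebraMap_mem_maximalIdeal_adicCompletion`, `FormalBranchesLocal.lean`).
[folklore] -/
private theorem exists_sub_algebraMap_mem_maximalIdeal_completion
    (y : AdicCompletion (maximalIdeal A) A) :
    ∃ a : A, y - algebraMap A _ a ∈ maximalIdeal (AdicCompletion (maximalIdeal A) A) := by
  obtain ⟨z, hz⟩ := (AdicCompletion.residueField_map_bijective A).2 (residue _ y)
  obtain ⟨a, rfl⟩ := residue_surjective z
  refine ⟨a, ?_⟩
  rw [← residue_eq_zero_iff, map_sub, sub_eq_zero, ← hz, ResidueField.map_residue]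

/-- **Residue algebraicity of `S` over `A` from that of `𝒪_v̂` over `Â`.** For a Noetherian
local ring `A` with completion `Â`, a local `Â`-algebra `S` dominated by `Â` (`Â → S` local)
mapping to a field `K₁`, and a valuation ring `O'` of `K₁` containing and dominating `S` whose
residue field is algebraic over that of `Â` (elementary form, polynomials over `Â`; from a
presentation `π : Â ↠ R` as in `exists_minimalPrime_valuationSubring_adicCompletion` lift the
polynomials along `π`, `Polynomial.map_surjective`): every element of `S` is a root modulo `𝔪_S`
of a polynomial over `A` with a coefficient outside `𝔪_A` — the hypothesis `halg` of
`exists_adjoin_isRegularLocalRing_of_generators`. [cite: CossartPiltant2019, proof of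
Prop. 4.8 (arXiv v1: Prop. 4.6, p. 53)] -/
theorem exists_eval₂_mem_maximalIdeal_of_valuation_adicCompletion
    {S K₁ : Type u} [CommRing S] [IsLocalRing S] [Field K₁]
    [Algebra (AdicCompletion (maximalIdeal A) A) S]
    [IsLocalHom (algebraMap (AdicCompletion (maximalIdeal A) A) S)] [Algebra A S]
    [IsScalarTower A (AdicCompletion (maximalIdeal A) A) S] [Algebra S K₁]
    [Algebra (AdicCompletion (maximalIdeal A) A) K₁]
    [IsScalarTower (AdicCompletion (maximalIdeal A) A) S K₁]
    (O' : ValuationSubring K₁) (hSO' : ∀ s : S, algebraMap S K₁ s ∈ O')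
    (hdomS : ∀ s ∈ maximalIdeal S, O'.valuation (algebraMap S K₁ s) < 1)
    (halg : ∀ x : O', ∃ p : (AdicCompletion (maximalIdeal A) A)[X],
      (∃ i, p.coeff i ∉ maximalIdeal (AdicCompletion (maximalIdeal A) A)) ∧
      O'.valuation (p.eval₂ (algebraMap (AdicCompletion (maximalIdeal A) A) K₁) x) < 1)
    (x : S) :
    ∃ p : A[X], (∃ i, p.coeff i ∉ maximalIdeal A) ∧
      p.eval₂ (algebraMap A S) x ∈ maximalIdeal S := by
  refine exists_eval₂_mem_maximalIdeal_of_valuation (R := AdicCompletion (maximalIdeal A) A)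
    (fun a ha => ?_) exists_sub_algebraMap_mem_maximalIdeal_completion (fun r hr => ?_)
    O' hSO' hdomS halg x
  · rw [AdicCompletion.maximalIdeal_eq_map]
    exact Ideal.mem_map_of_mem _ ha
  · exact (IsLocalRing.mem_maximalIdeal _).mpr fun hu =>
      ((IsLocalRing.mem_maximalIdeal r).mp hr) ((isUnit_map_iff (algebraMap _ S) r).mp hu)

/-! ## The hypothesis of Prop. 4.8 applies to the formal branches of `A` -/

/-- A surjective image of a complete Noetherian local ring is complete (Matsumura, proof of
Thm. 32.3, p. 257; cf. `isAdicComplete_quotient`, the case of `A ⧸ I`).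
[cite: Matsumura1987, §32 p. 257, proof of Thm. 32.3] -/
theorem isAdicComplete_of_surjective [IsAdicComplete (maximalIdeal A) A] {R : Type u}
    [CommRing R] [IsLocalRing R] (π : A →+* R) (hπ : Function.Surjective π) :
    IsAdicComplete (maximalIdeal R) R := by
  letI : Algebra A R := π.toAlgebra
  have hmap : (maximalIdeal A).map (algebraMap A R) = maximalIdeal R :=
    IsLocalRing.map_maximalIdeal_of_surjective _ hπ
  rw [← hmap, IsAdicComplete.map_algebraMap_iff, ← AdicCompletion.of_bijective_iff]
  haveI : Module.Finite A R := Module.Finite.of_surjective (Algebra.linearMap A R) hπ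
  refine ⟨AdicCompletion.of_injective_iff.mpr inferInstance, fun y => ?_⟩
  obtain ⟨z, rfl⟩ := AdicCompletion.map_surjective (maximalIdeal A)
    (f := Algebra.linearMap A R) hπ y
  obtain ⟨a, rfl⟩ := (AdicCompletion.of_bijective (maximalIdeal A) A).2 z
  exact ⟨Algebra.linearMap A R a, (AdicCompletion.map_of _ _ a).symm⟩

end Completion

/-- **"By assumption in this proposition … theorem 1.1 holds for `X̂ := Spec Â`" — the part of it
that needs no patching** (Cossart–Piltant 2019, proof of Prop. 4.8 = arXiv v1 Prop. 4.6, p. 53: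
"`Â` is reduced … `K̂ᵢ = QF(Â/P̂ᵢ)` and the `P̂ᵢ`'s are minimal primes … `r ≤ d := dim(Â/P̂₁)`").
For `A = B_𝔭` the local ring of an algebra `B` of finite type over a field (a domain) at a prime
with `dim B_𝔭 = 3`, every formal branch `R = Â/P̂` (`P̂` a minimal prime of `Â`, `R` presented by
any surjection `π : Â ↠ R` onto a local domain with `ker π = P̂`) is a complete Noetherian local
domain OF DIMENSION THREE (`ringKrullDim_quotient_eq_of_mem_minimalPrimes_adicCompletion_localization`,
formal equidimensionality over a field; completeness `isAdicComplete_of_surjective`), so the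
hypothesis `CossartPiltant2019LUComplete3` of `CossartPiltant2019LU3OfComplete` applies to it:
`R` has Cossart–Piltant's property (LU). Together with
`exists_minimalPrime_valuationSubring_adicCompletion` (the valuation `v̂` on `K̂₁` with the (LU)
hypotheses over `R`) this is the input from which the printed proof builds `𝒪_{Ŷ,ŷ}`.
[cite: CossartPiltant2019, proof of Prop. 4.8 (arXiv v1: Prop. 4.6, p. 53)] -/
theorem CossartPiltant2019LUComplete3.cpLocalUniformization_of_surjective
    (hc : CossartPiltant2019LUComplete3.{u}) {k B : Type u} [Field k] [CommRing B] [IsDomain B]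
    [Algebra k B] [Algebra.FiniteType k B] (p : Ideal B) [p.IsPrime]
    (hdim : ringKrullDim (Localization.AtPrime p) = 3)
    {R : Type u} [CommRing R] [IsDomain R] [IsLocalRing R]
    (π : AdicCompletion (maximalIdeal (Localization.AtPrime p)) (Localization.AtPrime p) →+* R)
    (hπ : Function.Surjective π)
    (hker : RingHom.ker π ∈ minimalPrimes
      (AdicCompletion (maximalIdeal (Localization.AtPrime p)) (Localization.AtPrime p))) :
    CPLocalUniformization R := by
  set A := Localization.AtPrime p with hAdef
  haveI : IsNoetherianRing B := Algebra.FiniteType.isNoetherianRing k B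
  haveI : IsNoetherianRing A := IsLocalization.isNoetherianRing p.primeCompl _ inferInstance
  set Ah := AdicCompletion (maximalIdeal A) A with hAhdef
  haveI : IsNoetherianRing Ah := isNoetherianRing_adicCompletion_maximalIdeal A
  -- `R` is Noetherian and complete
  haveI : IsNoetherianRing R := isNoetherianRing_of_surjective Ah R π hπ
  haveI : IsAdicComplete (maximalIdeal R) R := isAdicComplete_of_surjective π hπ
  -- `dim R = dim Â/ker π = dim A = 3`
  have hdimR : ringKrullDim R = 3 := by
    have h1 := ringKrullDim_quotient_eq_of_mem_minimalPrimes_adicCompletion_localization k p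
      (RingHom.ker π) hker
    rw [← hdim, ← h1]
    exact (ringKrullDim_eq_of_ringEquiv (RingHom.quotientKerEquivOfSurjective hπ)).symm
  exact hc R hdimR

end Literature.AlgebraicGeometry.Resolution

end
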